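import Mathlib.MeasureTheory.Function.ConditionalExpectation.Real
import Mathlib.MeasureTheory.Function.ConditionalExpectation.PullOut
import Mathlib.MeasureTheory.Measure.WithDensity
import Mathlib.MeasureTheory.Integral.Bochner.Set
import Mathlib.MeasureTheory.Integral.Bochner.ContinuousLinearMap
import HarnessLib

/-!
# `InformationPercolationEngine.KickFairRelEquilibrium` (stmt-AtomisticToContinuum-14914):
# conditional expectations are invariant under an `m`-measurable change of density

Helper file (`--supports stmt-AtomisticToContinuum-14914`) of the line `Sketch` (card
`affine-fibre-statics`, composed form). Pure measure theory (Bayes' rule for conditional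
expectations in the degenerate case of an `m`-measurable density): if `ρ : Ω → ℝ≥0` is measurable
with respect to the sub-σ-algebra `m ≤ m0`, `μ` is finite and `f`, `ρ f` are `μ`-integrable, then

  `(μ.withDensity ρ)[f | m] = μ[f | m]`   `(μ.withDensity ρ)`-almost everywhere

(`condExp_withDensity_ae_eq_of_measurable`). In the crux each hard-sphere kick is centred at the
conditional mean `κ = E_{G₁}[g(X) | σ(P)]` under the Gibbs law at temperature `1`; the density
`dG_θ/dG₁` is a function of the conserved kinetic energy, hence `σ(P)`-measurable, so `κ` is also
the conditional mean under `G_θ`.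

Proof. By the uniqueness lemma `ae_eq_condExp_of_forall_setIntegral_eq` for the measure
`ν = μ.withDensity ρ` and the candidate `μ[f | m]`: for an `m`-measurable set `s`,
`∫_s μ[f|m] dν = ∫_s ρ μ[f|m] dμ = ∫_s μ[ρ f|m] dμ = ∫_s ρ f dμ = ∫_s f dν`, the middle step being
the pull-out property `μ[ρ f | m] = ρ μ[f | m]` (`condExp_mul_of_stronglyMeasurable_left`).
-/

noncomputable section

open MeasureTheory Set Filter Topology
open scoped ENNReal

namespace Summit.AtomisticToContinuum.HydrodynamicLimit.Theorems

/-- **Conditional expectation under an `m`-measurable change of density.** If the density `ρ` is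
measurable with respect to the sub-σ-algebra `m`, then the conditional expectation of `f` given `m`
is the same under `μ` and under `μ.withDensity ρ` (almost everywhere for the latter). [folklore] -/
theorem condExp_withDensity_ae_eq_of_measurable :
    ∀ {Ω : Type*} {m m0 : MeasurableSpace Ω}, m ≤ m0 →
      ∀ (μ : Measure Ω) [IsFiniteMeasure μ] (ρ : Ω → NNReal), Measurable[m] ρ →
      ∀ [IsFiniteMeasure (μ.withDensity fun x => (ρ x : ℝ≥0∞))] (f : Ω → ℝ), Integrable f μ →
      Integrable (fun x => (ρ x : ℝ) * f x) μ →
      MeasureTheory.condExp m (μ.withDensity fun x => (ρ x : ℝ≥0∞)) f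
        =ᵐ[μ.withDensity fun x => (ρ x : ℝ≥0∞)] MeasureTheory.condExp m μ f := by
  intro Ω m m0 hm μ _ ρ hρ _ f hf hρf
  -- `ρ` is also `m0`-measurable, and its real version is `m`-strongly measurable.
  have hρ0 : Measurable[m0] ρ := hρ.mono hm le_rfl
  have hρm : StronglyMeasurable[m] (fun x => (ρ x : ℝ)) :=
    (measurable_coe_nnreal_real.comp hρ).stronglyMeasurable
  -- the pull-out property under `μ`
  have hpull : μ[(fun x => (ρ x : ℝ) * f x)|m] =ᵐ[μ] fun x => (ρ x : ℝ) * (μ[f|m]) x :=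
    condExp_mul_of_stronglyMeasurable_left (f := fun x => (ρ x : ℝ)) (g := f) hρm hρf hf
  -- integrability of `f` and of `μ[f|m]` under `ν = μ.withDensity ρ`
  have hfν : Integrable f (μ.withDensity fun x => (ρ x : ℝ≥0∞)) := by
    rw [integrable_withDensity_iff_integrable_smul hρ0]
    simpa only [NNReal.smul_def, smul_eq_mul] using hρf
  have hgν : Integrable (μ[f|m]) (μ.withDensity fun x => (ρ x : ℝ≥0∞)) := by
    rw [integrable_withDensity_iff_integrable_smul hρ0]
    have hint : Integrable (μ[(fun x => (ρ x : ℝ) * f x)|m]) μ := integrable_condExp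
    refine (hint.congr hpull).congr (Eventually.of_forall fun x => ?_)
    simp only [NNReal.smul_def, smul_eq_mul]
  refine (ae_eq_condExp_of_forall_setIntegral_eq hm hfν (fun s _ _ => hgν.integrableOn)
    (fun s hs _ => ?_) stronglyMeasurable_condExp.aestronglyMeasurable).symm
  -- the defining set identity on an `m`-measurable set `s`
  rw [setIntegral_withDensity_eq_setIntegral_smul hρ0 _ (hm s hs),
    setIntegral_withDensity_eq_setIntegral_smul hρ0 _ (hm s hs)]
  have h1 : ∫ x in s, ρ x • (μ[f|m]) x ∂μ = ∫ x in s, (μ[(fun x => (ρ x : ℝ) * f x)|m]) x ∂μ := by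
    refine setIntegral_congr_ae (hm s hs) ?_
    filter_upwards [hpull] with x hx _
    rw [hx, NNReal.smul_def, smul_eq_mul]
  rw [h1, setIntegral_condExp hm hρf hs]
  refine setIntegral_congr_fun (hm s hs) fun x _ => ?_
  rw [NNReal.smul_def, smul_eq_mul]

end Summit.AtomisticToContinuum.HydrodynamicLimit.Theorems

end
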